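import Summits.QuantumFields.YangMills.Theses.MirrorModularBoosts
import Literature.MathematicalPhysics.QuantumFieldTheory.OSReconstructionNoE1
import Literature.MathematicalPhysics.QuantumFieldTheory.OSReconstructionNoE1Proofs

/-!
# Line `cone-ordered-density-holomorphic-gaps` — skeleton for crux `PlanarSpectralCone` (stmt-QuantumFields-9664)

Route `MirrorModularBoosts`, crux (C) `Summit.QuantumFields.YangMills.Theses.MirrorModularBoosts.PlanarSpectralCone`
(model-blind planar spectral cone `H ≥ |P₁|` from reflection positivity in the eight planar frames).

The line proves the crux through the OPERATOR form on the `e₀` Osterwalder–Schrader space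
`h : OSReconstructionNoE1 𝔖.toLabelled` (E2 along `e₀` + translations, both crux hypotheses):

* `stub_discContinuation` (A, slot FRONT END; the only stub that uses the DIAGONAL frames — honours
  cdisprove `false_without_diagonalFrames`): for a CONE-ORDERED `G` (support a `W`-chain,
  `W = {x₀ > |x₁|}`) the diagonal matrix element `b ↦ ⟪Ψ_G, e^{-tH} U(b e₁) Ψ_G⟫` continues to the disc
  `|β| < t` with a `t`-uniform bound (two diagonal OS semigroups = two slots of the tree's
  `LogSlot.IsSectorData` engine at opening `π/2`; Thales / `cross_slice_iff_disc`).
* `stub_coneOfDiscContinuation` (B, BACK END, pure measure theory): such disc continuations of the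
  Laplace–Fourier transform of a finite positive measure on `{p₀ ≥ 0}` force `μ {p₀ < |p₁|} = 0`
  (Lukacs/Landau–Pringsheim + ray asymptotics = cdisprove's proved `cone_of_laplace_bound`).
* `stub_coneSupportedClosedSpan` (C, linearity): vectors whose joint `(H,P⃗)` spectral measures are
  cone-supported form a closed subspace (uniqueness of `μ_ψ` + positive sesquilinear structure; the
  tree's `IsJointSpectralMeasure` is per-vector, no PVM).
* `stub_typedConeOfConeSupported` (D, TRANSFER `C⁺ → C`): cone support on `span{Ψ_F, Ψ_G}` gives the
  crux's typed conclusion for `(F, G)` verbatim, with the SHARP Cauchy–Schwarz constant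
  (`e^{-ζH+iβP₁} = T(ζ/2,β/2)* T(ζ/2,β/2)` at measure level) — honours `Concl.real_bound`.
* `stub_coneOrderedDense` (E, THIS CARD, hardest): every time-ordered field vector `Ψ_F` lies in the
  closed span of the cone-ordered ones — stretching one time gap is a holomorphic `ℋ`-valued map
  (Gram kernel = 2-slot sector data from `e₀`-E2 + translations + E3 + temperedness, Glaser,
  `exists_holomorphic_gramVec`, identity theorem), iterated over the gaps.

`planarSpectralCone_of_stubs : (A) → (B) → (C) → (D) → (E) → ⟨statement of PlanarSpectralCone⟩` is
proved below with NO sorry (the five hypotheses are the stub statements binder for binder), and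
`PlanarSpectralCone_of : PlanarSpectralCone := planarSpectralCone_of_stubs stub_A … stub_E` is the
crux proof BY NAME, closed modulo the five registered `stub_*` (the only sorries in the file).
-/

noncomputable section

open MeasureTheory Complex Set Filter
open scoped InnerProductSpace ComplexConjugate Topology
open Literature.MathematicalPhysics.QuantumLattice Literature.MathematicalPhysics.AQFT
  Literature.MathematicalPhysics.QuantumFieldTheory

namespace Summit.QuantumFields.YangMills.Cruxes.PlanarSpectralCone.ConeOrderedDensityHolomorphicGaps

/-! ## Vocabulary (sorry-free) -/

/-- The open forward light wedge `W = {x₀ > |x₁|}` of the `(x₀,x₁)`-plane (times `ℝ²` in `x₂, x₃`):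
the Euclidean shadow of the Minkowski right wedge, bounded by the two diagonal mirrors. -/
def wedge : Set (EuclideanSpace ℝ (Fin 4)) := {v | |v 1| < v 0}

/-- Cone-ordered (`W`-chain) configurations: every point and every forward difference lies in `W`.
Such configurations are time-ordered along `e₀`, `(e₀+e₁)/√2` and `(e₀−e₁)/√2` simultaneously. -/
def coneChain (m : ℕ) : Set (Fin m → EuclideanSpace ℝ (Fin 4)) :=
  {x | (∀ i, x i ∈ wedge) ∧ ∀ i j, i < j → x j - x i ∈ wedge}

/-- A test function whose support is a set of `W`-chains ("cone-ordered") is time-ordered (so it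
has a field vector `Ψ_G`); cone-ordering is written `tsupport G ⊆ coneChain m` throughout. -/
theorem isTimeOrdered_of_coneChain {m : ℕ} {G : SchwartzMap (Fin m → EuclideanSpace ℝ (Fin 4)) ℂ}
    (hG : tsupport (G : (Fin m → EuclideanSpace ℝ (Fin 4)) → ℂ) ⊆ coneChain m) : IsTimeOrdered G := by
  intro x hx
  obtain ⟨h1, h2⟩ := hG hx
  refine ⟨fun i => ?_, fun i j hij => ?_⟩
  · have hi : |x i 1| < x i 0 := h1 i
    exact lt_of_le_of_lt (abs_nonneg _) hi
  · have hij' : |(x j - x i) 1| < (x j - x i) 0 := h2 i j hij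
    simp only [PiLp.sub_apply] at hij'
    have h0 : (0 : ℝ) ≤ |x j 1 - x i 1| := abs_nonneg _
    show x i 0 < x j 0
    linarith

variable {S : SchwingerFamily (EuclideanSpace ℝ (Fin 4))}

/-- The cone-ordered field vectors `Ψ_G` (any arity) of the `e₀` Osterwalder–Schrader space. -/
def coneOrderedVecs (h : OSReconstructionNoE1 S.toLabelled) : Set h.Hilbert :=
  {ψ | ∃ (m : ℕ) (G : SchwartzMap (Fin m → EuclideanSpace ℝ (Fin 4)) ℂ)
    (hG : tsupport (G : (Fin m → EuclideanSpace ℝ (Fin 4)) → ℂ) ⊆ coneChain m),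
    ψ = h.fieldVec m (fun _ => ()) G (isTimeOrdered_of_coneChain hG)}

/-- Vectors all of whose joint `(H, P⃗)` spectral measures are carried by the closed light cone
`{p₀ ≥ |p₁|}` of the `(p₀,p₁)`-plane (the operator statement `H ≥ |P₁|` at `ψ`). -/
def coneSupported (h : OSReconstructionNoE1 S.toLabelled) : Set h.Hilbert :=
  {ψ | ∀ μ : Measure (EuclideanSpace ℝ (Fin 4)), h.IsJointSpectralMeasure ψ μ → μ {p | p 0 < |p 1|} = 0}

/-- The frame `R = 1` (`a = 1`, `b = 0`) of hypothesis 4 is E2 of `𝔖` itself along `e₀`. -/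
theorem isReflectionPositive_of_eightFrameRP
    (hRP : (∀ (R : EuclideanSpace ℝ (Fin 4) ≃ₗᵢ[ℝ] EuclideanSpace ℝ (Fin 4)) (a b : ℝ), a ^ 2 + b ^ 2 = 1 →
      (a = 0 ∨ b = 0 ∨ a ^ 2 = b ^ 2) →
        R (EuclideanSpace.single 0 1) = a • EuclideanSpace.single 0 1 + b • EuclideanSpace.single 1 1 →
          (SchwingerFamily.toLabelled (fun n => (S n).comp (linActMulti R))).IsReflectionPositive)) :
    S.toLabelled.IsReflectionPositive := by
  have h := hRP (LinearIsometryEquiv.refl ℝ (EuclideanSpace ℝ (Fin 4))) 1 0 (by norm_num)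
    (Or.inr (Or.inl rfl)) (by simp)
  have hlin : (fun n => (S n).comp
      (linActMulti (n := n) (LinearIsometryEquiv.refl ℝ (EuclideanSpace ℝ (Fin 4))))) = S := by
    funext n
    ext F
    rw [ContinuousLinearMap.comp_apply]
    rfl
  rw [hlin] at h
  exact h

/-- Hypothesis 3 is translation invariance on `⁰𝒮` of the labelled family `𝔖.toLabelled`. -/
theorem isTranslationInvariant_of_translInv
    (htr : (∀ (n : ℕ) (a : EuclideanSpace ℝ (Fin 4)) (F : SchwartzMap (Fin n → EuclideanSpace ℝ (Fin 4)) ℂ),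
      IsOffDiagonal F → S n (translateMulti a F) = S n F)) :
    S.toLabelled.IsTranslationInvariant :=
  fun n _ a F hF => htr n a F hF

/-- The premises of `e₀` Osterwalder–Schrader reconstruction without E1 hold under the crux
hypotheses (uses cdisprove's `false_without_translation` input and the `e₀` frame). -/
theorem osReconstruction
    (htr : (∀ (n : ℕ) (a : EuclideanSpace ℝ (Fin 4)) (F : SchwartzMap (Fin n → EuclideanSpace ℝ (Fin 4)) ℂ),
      IsOffDiagonal F → S n (translateMulti a F) = S n F))
    (hRP : (∀ (R : EuclideanSpace ℝ (Fin 4) ≃ₗᵢ[ℝ] EuclideanSpace ℝ (Fin 4)) (a b : ℝ), a ^ 2 + b ^ 2 = 1 →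
      (a = 0 ∨ b = 0 ∨ a ^ 2 = b ^ 2) →
        R (EuclideanSpace.single 0 1) = a • EuclideanSpace.single 0 1 + b • EuclideanSpace.single 1 1 →
          (SchwingerFamily.toLabelled (fun n => (S n).comp (linActMulti R))).IsReflectionPositive)) :
    OSReconstructionNoE1 S.toLabelled :=
  ⟨isReflectionPositive_of_eightFrameRP hRP, isTranslationInvariant_of_translInv htr⟩

/-! ## The five stubs

Each `theorem stub_… := by sorry` is a registered stub with explicit binders (the signature
stub-workers prove via `propose --supports stmt-QuantumFields-9664`); `planarSpectralCone_of_stubs`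
restates the five signatures as its hypotheses and `PlanarSpectralCone_of` type-checks only if the
spellings agree. -/

/-- **(A) Disc continuation for cone-ordered diagonal pairs** (slot front end; cards
`two-mirror-lightcone-slots` ≈ `lightcone-sector-engine`). For cone-ordered `G` the matrix element
`b ↦ ⟪Ψ_G, e^{-tH} U(b e₁) Ψ_G⟫ = 𝔖(ΘG* ⊗ G_{t e₀ + b e₁})` is, for every `t > 0`, the restriction of
a function holomorphic on the disc `|β| < t`, bounded by a constant `M` independent of `t`.
Route: the pull-backs of `𝔖` by frames with time axis `(e₀ ± e₁)/√2` are RP (hypothesis 4 with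
`a² = b² = 1/2`) and translation invariant, so `u ↦ 𝔖(ΘG*⊗G_{u n + u' n'})` and `u' ↦ …` are OS
semigroup matrix elements of two further `OSReconstructionNoE1` spaces (cone-ordered supports are
ordered along `e₀, n, n'` at once; frame identity `θₙ θ₀ = R₉₀`), bounded by frame norms uniformly in
the real partner: `LogSlot.IsSectorData (π/2)` with `p = 0` ⇒ holomorphy + sharp bound on
`sectorRegion 1 (π/2)` (triage TwoSlot.lean / W1.lean, proved), whose section at real `ζ = t` is the
disc `|β| < t` (Thales; cdisprove `cross_slice_iff_disc`). -/
theorem stub_discContinuation (S : SchwingerFamily (EuclideanSpace ℝ (Fin 4)))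
    (hE0' : S.toLabelled.HasLinearGrowth) (hE3 : S.toLabelled.IsSymmetric)
    (htr : (∀ (n : ℕ) (a : EuclideanSpace ℝ (Fin 4)) (F : SchwartzMap (Fin n → EuclideanSpace ℝ (Fin 4)) ℂ),
      IsOffDiagonal F → S n (translateMulti a F) = S n F))
    (hRP : (∀ (R : EuclideanSpace ℝ (Fin 4) ≃ₗᵢ[ℝ] EuclideanSpace ℝ (Fin 4)) (a b : ℝ), a ^ 2 + b ^ 2 = 1 →
      (a = 0 ∨ b = 0 ∨ a ^ 2 = b ^ 2) →
        R (EuclideanSpace.single 0 1) = a • EuclideanSpace.single 0 1 + b • EuclideanSpace.single 1 1 →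
          (SchwingerFamily.toLabelled (fun n => (S n).comp (linActMulti R))).IsReflectionPositive))
    (h : OSReconstructionNoE1 S.toLabelled) (m : ℕ)
    (G : SchwartzMap (Fin m → EuclideanSpace ℝ (Fin 4)) ℂ)
    (hG : tsupport (G : (Fin m → EuclideanSpace ℝ (Fin 4)) → ℂ) ⊆ coneChain m) :
    ∃ M : ℝ, ∀ t : ℝ, 0 < t → ∃ f : ℂ → ℂ, DifferentiableOn ℂ f (Metric.ball 0 t) ∧
      (∀ b : ℝ, |b| < t → f b = ⟪h.fieldVec m (fun _ => ()) G (isTimeOrdered_of_coneChain hG),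
        h.transfer t (h.translate (EuclideanSpace.single 1 b)
          (h.fieldVec m (fun _ => ()) G (isTimeOrdered_of_coneChain hG)))⟫_ℂ) ∧
      ∀ β ∈ Metric.ball (0 : ℂ) t, ‖f β‖ ≤ M := by
  sorry

/-- **(B) Disc continuation ⇒ cone support** (back end, pure measure theory; card
`positivity-disc-to-operator-cone`). A finite positive measure `μ` on `{p₀ ≥ 0} ⊂ ℝ⁴` whose
Laplace–Fourier transform `b ↦ ∫ e^{-t p₀ + i b p₁} dμ` is, for every `t > 0`, the restriction to
`(-t, t)` of a function holomorphic on the disc `|β| < t` and bounded there by a `t`-independent `M`,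
charges no mass outside the closed light cone. Route: Lukacs / Landau–Pringsheim (a characteristic
function analytic on the disc of radius `t` has exponential moments of order `< t` and its strip
continuation is `∫ e^{iβq} dν`), so `∫ e^{-tp₀+σp₁} dμ = f(-iσ) ≤ M` for `|σ| < t`; then ray
asymptotics (cdisprove's proved `cone_of_laplace_bound`: `∫ e^{-tE-σp} dμ ≤ M ∀ |σ|<t ⇒ μ{E<|p|} = 0`). -/
theorem stub_coneOfDiscContinuation (μ : Measure (EuclideanSpace ℝ (Fin 4))) [IsFiniteMeasure μ]
    (hE : μ {p | p 0 < 0} = 0) (M : ℝ)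
    (hdisc : ∀ t : ℝ, 0 < t → ∃ f : ℂ → ℂ, DifferentiableOn ℂ f (Metric.ball 0 t) ∧
      (∀ b : ℝ, |b| < t → f b = ∫ p, Complex.exp (((-(t * p 0) : ℝ) : ℂ) +
        ((⟪EuclideanSpace.single (1 : Fin 4) b, p⟫_ℝ : ℝ) : ℂ) * Complex.I) ∂μ) ∧
      ∀ β ∈ Metric.ball (0 : ℂ) t, ‖f β‖ ≤ M) :
    μ {p | p 0 < |p 1|} = 0 := by
  sorry

/-- **(C) Cone-supported vectors form a closed subspace** (PVM-level linearity over the per-vector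
predicate `IsJointSpectralMeasure`): the closed span of any set of cone-supported vectors is
cone-supported. Route: joint spectral measures exist (`exists_isJointSpectralMeasure_holds`) and are
unique (Laplace in `t ≥ 0` on `{p₀ ≥ 0}` + Fourier in `a⃗`, `Measure.ext_of_charFun`), hence
`ψ ↦ μ_ψ` is a positive quadratic map (polarised measures are sesquilinear), `μ_ψ(N)^{1/2}` is a
seminorm bounded by `‖ψ‖` (`measureReal_univ`), and its kernel is a closed subspace. -/
theorem stub_coneSupportedClosedSpan (S : SchwingerFamily (EuclideanSpace ℝ (Fin 4)))
    (h : OSReconstructionNoE1 S.toLabelled) (s : Set h.Hilbert) (hs : s ⊆ coneSupported h) :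
    ((Submodule.span ℂ s).topologicalClosure : Set h.Hilbert) ⊆ coneSupported h := by
  sorry

/-- **(D) Transfer `C⁺ → C`: operator cone on `span{Ψ_F, Ψ_G}` gives the crux's typed conclusion
for `(F, G)`** verbatim (holomorphic `Φ` on `{|Im β| < Re ζ}` through the real points
`𝔖(ΘF* ⊗ G_{t e₀ + b e₁})`, with the sharp bound `‖Φ‖² ≤ 𝔖(ΘF*F) 𝔖(ΘG*G)`). Route:
`Φ(ζ,β) := ∫ e^{-ζp₀ + iβp₁} dμ_{Ψ_F,Ψ_G}` with the polarised (complex, cone-supported) measure;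
holomorphy by dominated convergence (`|e^{-ζp₀+iβp₁}| ≤ e^{-(Re ζ - |Im β|)p₀} ≤ 1` on the cone);
real points by `transfer_fieldVec`, `translate_fieldVec`, `inner_fieldVec_fieldVec`
(`t e₀ + b e₁ = timeVec t + spatialPart 0 (b e₁)`); the SHARP constant from the Cauchy–Schwarz
inequality of the positive-semidefinite measure-valued form `(φ,ψ) ↦ μ_{φ,ψ}` with the splitting
`e^{-ζp₀+iβp₁} = conj(u) v`, `|u|², |v|² = e^{-Re ζ p₀ - Im β p₁} ≤ 1`, and `μ_ψ(ℝ⁴) = ‖ψ‖²`;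
degenerate `n = 0 ∨ m = 0` is the `2×2` Gram case (refuter g41-34 / g41-8 junk audit). -/
theorem stub_typedConeOfConeSupported (S : SchwingerFamily (EuclideanSpace ℝ (Fin 4)))
    (h : OSReconstructionNoE1 S.toLabelled) (n m : ℕ)
    (F : SchwartzMap (Fin n → EuclideanSpace ℝ (Fin 4)) ℂ)
    (G : SchwartzMap (Fin m → EuclideanSpace ℝ (Fin 4)) ℂ) (hF : IsTimeOrdered F) (hG : IsTimeOrdered G)
    (hcone : ∀ a b : ℂ, a • h.fieldVec n (fun _ => ()) F hF + b • h.fieldVec m (fun _ => ()) G hG ∈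
      coneSupported h) :
    ∃ Φ : ℂ × ℂ → ℂ, DifferentiableOn ℂ Φ {w : ℂ × ℂ | |w.2.im| < w.1.re} ∧
      (∀ (t b : ℝ), 0 < t → ∀ H : SchwartzMap (Fin (n + m) → EuclideanSpace ℝ (Fin 4)) ℂ,
        IsAppendTensorOf H (osAdjoint F)
          (translateMulti (t • EuclideanSpace.single 0 1 + b • EuclideanSpace.single 1 1) G) →
          Φ ((t : ℂ), (b : ℂ)) = S (n + m) H) ∧
      (∀ w ∈ {w : ℂ × ℂ | |w.2.im| < w.1.re},
        ∀ (HF : SchwartzMap (Fin (n + n) → EuclideanSpace ℝ (Fin 4)) ℂ)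
          (HG : SchwartzMap (Fin (m + m) → EuclideanSpace ℝ (Fin 4)) ℂ),
          IsAppendTensorOf HF (osAdjoint F) F → IsAppendTensorOf HG (osAdjoint G) G →
            ‖Φ w‖ ^ 2 ≤ ‖S (n + n) HF‖ * ‖S (m + m) HG‖) := by
  sorry

/-- **(E) Density of cone-ordered vectors** (THIS CARD's lever; hardest stub). Every field vector
`Ψ_F` of a time-ordered `F` lies in the closed span of the cone-ordered field vectors. Route
(e₀-frame E2 + translations from `h`, E3 = `hE3`, temperedness of each `𝔖ₙ`; `hE0'`, `hRP` idle):
reduce by continuity of `F ↦ Ψ_F` (`‖Ψ_F‖² = 𝔖₂ₙ(ΘF*⊗F)`) to compactly supported full tensors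
`F = f₁ ⊗ ⋯ ⊗ fₙ` with time-separated factors (cutoff + partition of unity + tensor density);
stretch gap `k`: `F^{(s)}` = tail factors translated by `s e₀`; the Gram kernel
`K(s,s') = 𝔖₂ₙ(Θ(F^{(s)})* ⊗ F^{(s')})` is, after re-centring the mirror inside gap `k`
(translation invariance) and re-indexing the reflected blocks (E3), `⟪Ψ_{A(s)}, e^{-(s'-σ₀)H} Ψ_B⟫`:
2-slot `LogSlot.IsSectorData (π/2)` with polynomial growth (Schwartz seminorms of translates) ⇒
joint sesqui-holomorphy on `{|arg(s+δ)| + |arg(s'+δ)| < π/2}` ⇒ Glaser/RKHS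
`exists_holomorphic_gramVec` on `Ω = {|arg(z+δ)| < π/4}` (covered by real-centred discs `D` with
`D × D` in the sector region) ⇒ `s ↦ Ψ_{F^{(s)}}` is a holomorphic `ℋ`-valued map on `Ω ∋ 0` with values
in the closed span of its real points ⇒ (identity theorem) `Ψ_F ∈ closure span{Ψ_{F^{(s)}} : s ≥ s₀}`;
iterate over the `n - 1` gaps (a stretched gap stays wide) and finish with `e^{-sH}` (puts `x₁ ∈ W`;
`n = 1` needs no kernel). First lemma of the card = the abstract RKHS step
(`orthogonal_of_orthogonal_large_gaps`, near-corollary of `exists_holomorphic_gramVec` +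
`eqOn_of_eqOn_reals_hilbert`). -/
theorem stub_coneOrderedDense (S : SchwingerFamily (EuclideanSpace ℝ (Fin 4)))
    (hE0' : S.toLabelled.HasLinearGrowth) (hE3 : S.toLabelled.IsSymmetric)
    (htr : (∀ (n : ℕ) (a : EuclideanSpace ℝ (Fin 4)) (F : SchwartzMap (Fin n → EuclideanSpace ℝ (Fin 4)) ℂ),
      IsOffDiagonal F → S n (translateMulti a F) = S n F))
    (hRP : (∀ (R : EuclideanSpace ℝ (Fin 4) ≃ₗᵢ[ℝ] EuclideanSpace ℝ (Fin 4)) (a b : ℝ), a ^ 2 + b ^ 2 = 1 →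
      (a = 0 ∨ b = 0 ∨ a ^ 2 = b ^ 2) →
        R (EuclideanSpace.single 0 1) = a • EuclideanSpace.single 0 1 + b • EuclideanSpace.single 1 1 →
          (SchwingerFamily.toLabelled (fun n => (S n).comp (linActMulti R))).IsReflectionPositive))
    (h : OSReconstructionNoE1 S.toLabelled) (n : ℕ)
    (F : SchwartzMap (Fin n → EuclideanSpace ℝ (Fin 4)) ℂ) (hF : IsTimeOrdered F) :
    h.fieldVec n (fun _ => ()) F hF ∈
      ((Submodule.span ℂ (coneOrderedVecs h)).topologicalClosure : Set h.Hilbert) := by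
  sorry

/-! ## The composition (sorry-free) -/

/-- Under (A) and (B), every cone-ordered field vector is cone-supported. -/
theorem coneOrderedVecs_subset_coneSupported
    (hA : ∀ (S : SchwingerFamily (EuclideanSpace ℝ (Fin 4))), S.toLabelled.HasLinearGrowth →
        S.toLabelled.IsSymmetric →
        (∀ (n : ℕ) (a : EuclideanSpace ℝ (Fin 4)) (F : SchwartzMap (Fin n → EuclideanSpace ℝ (Fin 4)) ℂ),
          IsOffDiagonal F → S n (translateMulti a F) = S n F) →
        (∀ (R : EuclideanSpace ℝ (Fin 4) ≃ₗᵢ[ℝ] EuclideanSpace ℝ (Fin 4)) (a b : ℝ), a ^ 2 + b ^ 2 = 1 →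
          (a = 0 ∨ b = 0 ∨ a ^ 2 = b ^ 2) →
            R (EuclideanSpace.single 0 1) = a • EuclideanSpace.single 0 1 + b • EuclideanSpace.single 1 1 →
              (SchwingerFamily.toLabelled (fun n => (S n).comp (linActMulti R))).IsReflectionPositive) →
        ∀ (h : OSReconstructionNoE1 S.toLabelled) (m : ℕ)
          (G : SchwartzMap (Fin m → EuclideanSpace ℝ (Fin 4)) ℂ)
          (hG : tsupport (G : (Fin m → EuclideanSpace ℝ (Fin 4)) → ℂ) ⊆ coneChain m),
          ∃ M : ℝ, ∀ t : ℝ, 0 < t → ∃ f : ℂ → ℂ, DifferentiableOn ℂ f (Metric.ball 0 t) ∧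
            (∀ b : ℝ, |b| < t → f b = ⟪h.fieldVec m (fun _ => ()) G (isTimeOrdered_of_coneChain hG),
              h.transfer t (h.translate (EuclideanSpace.single 1 b)
                (h.fieldVec m (fun _ => ()) G (isTimeOrdered_of_coneChain hG)))⟫_ℂ) ∧
            ∀ β ∈ Metric.ball (0 : ℂ) t, ‖f β‖ ≤ M)
    (hB : ∀ (μ : Measure (EuclideanSpace ℝ (Fin 4))) [IsFiniteMeasure μ], μ {p | p 0 < 0} = 0 → ∀ (M : ℝ),
        (∀ t : ℝ, 0 < t → ∃ f : ℂ → ℂ, DifferentiableOn ℂ f (Metric.ball 0 t) ∧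
          (∀ b : ℝ, |b| < t → f b = ∫ p, Complex.exp (((-(t * p 0) : ℝ) : ℂ) +
            ((⟪EuclideanSpace.single (1 : Fin 4) b, p⟫_ℝ : ℝ) : ℂ) * Complex.I) ∂μ) ∧
          ∀ β ∈ Metric.ball (0 : ℂ) t, ‖f β‖ ≤ M) →
        μ {p | p 0 < |p 1|} = 0)
    (hE0' : S.toLabelled.HasLinearGrowth) (hE3 : S.toLabelled.IsSymmetric)
    (htr : (∀ (n : ℕ) (a : EuclideanSpace ℝ (Fin 4)) (F : SchwartzMap (Fin n → EuclideanSpace ℝ (Fin 4)) ℂ),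
      IsOffDiagonal F → S n (translateMulti a F) = S n F))
    (hRP : (∀ (R : EuclideanSpace ℝ (Fin 4) ≃ₗᵢ[ℝ] EuclideanSpace ℝ (Fin 4)) (a b : ℝ), a ^ 2 + b ^ 2 = 1 →
      (a = 0 ∨ b = 0 ∨ a ^ 2 = b ^ 2) →
        R (EuclideanSpace.single 0 1) = a • EuclideanSpace.single 0 1 + b • EuclideanSpace.single 1 1 →
          (SchwingerFamily.toLabelled (fun n => (S n).comp (linActMulti R))).IsReflectionPositive))
    (h : OSReconstructionNoE1 S.toLabelled) :
    coneOrderedVecs h ⊆ coneSupported h := by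
  rintro ψ ⟨m', G', hG', rfl⟩ μ hμ
  haveI := hμ.isFiniteMeasure
  obtain ⟨M, hM⟩ := hA S hE0' hE3 htr hRP h m' G' hG'
  refine hB μ hμ.energy_nonneg M fun t ht => ?_
  obtain ⟨f, hf, hfb, hbd⟩ := hM t ht
  refine ⟨f, hf, fun b hb => ?_, hbd⟩
  rw [hfb b hb]
  exact hμ.inner_transfer_translate t ht.le (EuclideanSpace.single 1 b) (by simp)

/-- **The line, as an implication** (sorry-free): (A) disc continuation for cone-ordered diagonal
pairs → (B) disc continuation forces cone support → (C) cone-supported vectors are a closed subspace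
→ (D) operator cone on `span{Ψ_F, Ψ_G}` gives the typed conclusion → (E) cone-ordered vectors are
dense ⟹ the statement of `PlanarSpectralCone` (spelled out: its conclusion is the crux's body, so
that the only theorem concluding the crux BY NAME is `PlanarSpectralCone_of` below; the definitional
agreement is certified by `PlanarSpectralCone_of` elaborating). The five hypotheses are, binder for
binder, the statements of `stub_discContinuation`, `stub_coneOfDiscContinuation`,
`stub_coneSupportedClosedSpan`, `stub_typedConeOfConeSupported`, `stub_coneOrderedDense`. -/
theorem planarSpectralCone_of_stubs
    (hA : ∀ (S : SchwingerFamily (EuclideanSpace ℝ (Fin 4))), S.toLabelled.HasLinearGrowth →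
        S.toLabelled.IsSymmetric →
        (∀ (n : ℕ) (a : EuclideanSpace ℝ (Fin 4)) (F : SchwartzMap (Fin n → EuclideanSpace ℝ (Fin 4)) ℂ),
          IsOffDiagonal F → S n (translateMulti a F) = S n F) →
        (∀ (R : EuclideanSpace ℝ (Fin 4) ≃ₗᵢ[ℝ] EuclideanSpace ℝ (Fin 4)) (a b : ℝ), a ^ 2 + b ^ 2 = 1 →
          (a = 0 ∨ b = 0 ∨ a ^ 2 = b ^ 2) →
            R (EuclideanSpace.single 0 1) = a • EuclideanSpace.single 0 1 + b • EuclideanSpace.single 1 1 →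
              (SchwingerFamily.toLabelled (fun n => (S n).comp (linActMulti R))).IsReflectionPositive) →
        ∀ (h : OSReconstructionNoE1 S.toLabelled) (m : ℕ)
          (G : SchwartzMap (Fin m → EuclideanSpace ℝ (Fin 4)) ℂ)
          (hG : tsupport (G : (Fin m → EuclideanSpace ℝ (Fin 4)) → ℂ) ⊆ coneChain m),
          ∃ M : ℝ, ∀ t : ℝ, 0 < t → ∃ f : ℂ → ℂ, DifferentiableOn ℂ f (Metric.ball 0 t) ∧
            (∀ b : ℝ, |b| < t → f b = ⟪h.fieldVec m (fun _ => ()) G (isTimeOrdered_of_coneChain hG),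
              h.transfer t (h.translate (EuclideanSpace.single 1 b)
                (h.fieldVec m (fun _ => ()) G (isTimeOrdered_of_coneChain hG)))⟫_ℂ) ∧
            ∀ β ∈ Metric.ball (0 : ℂ) t, ‖f β‖ ≤ M)
    (hB : ∀ (μ : Measure (EuclideanSpace ℝ (Fin 4))) [IsFiniteMeasure μ], μ {p | p 0 < 0} = 0 → ∀ (M : ℝ),
        (∀ t : ℝ, 0 < t → ∃ f : ℂ → ℂ, DifferentiableOn ℂ f (Metric.ball 0 t) ∧
          (∀ b : ℝ, |b| < t → f b = ∫ p, Complex.exp (((-(t * p 0) : ℝ) : ℂ) +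
            ((⟪EuclideanSpace.single (1 : Fin 4) b, p⟫_ℝ : ℝ) : ℂ) * Complex.I) ∂μ) ∧
          ∀ β ∈ Metric.ball (0 : ℂ) t, ‖f β‖ ≤ M) →
        μ {p | p 0 < |p 1|} = 0)
    (hC : ∀ (S : SchwingerFamily (EuclideanSpace ℝ (Fin 4))) (h : OSReconstructionNoE1 S.toLabelled)
        (s : Set h.Hilbert), s ⊆ coneSupported h →
          ((Submodule.span ℂ s).topologicalClosure : Set h.Hilbert) ⊆ coneSupported h)
    (hD : ∀ (S : SchwingerFamily (EuclideanSpace ℝ (Fin 4))) (h : OSReconstructionNoE1 S.toLabelled) (n m : ℕ)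
        (F : SchwartzMap (Fin n → EuclideanSpace ℝ (Fin 4)) ℂ)
        (G : SchwartzMap (Fin m → EuclideanSpace ℝ (Fin 4)) ℂ) (hF : IsTimeOrdered F) (hG : IsTimeOrdered G),
        (∀ a b : ℂ, a • h.fieldVec n (fun _ => ()) F hF + b • h.fieldVec m (fun _ => ()) G hG ∈
          coneSupported h) →
        ∃ Φ : ℂ × ℂ → ℂ, DifferentiableOn ℂ Φ {w : ℂ × ℂ | |w.2.im| < w.1.re} ∧
          (∀ (t b : ℝ), 0 < t → ∀ H : SchwartzMap (Fin (n + m) → EuclideanSpace ℝ (Fin 4)) ℂ,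
            IsAppendTensorOf H (osAdjoint F)
              (translateMulti (t • EuclideanSpace.single 0 1 + b • EuclideanSpace.single 1 1) G) →
              Φ ((t : ℂ), (b : ℂ)) = S (n + m) H) ∧
          (∀ w ∈ {w : ℂ × ℂ | |w.2.im| < w.1.re},
            ∀ (HF : SchwartzMap (Fin (n + n) → EuclideanSpace ℝ (Fin 4)) ℂ)
              (HG : SchwartzMap (Fin (m + m) → EuclideanSpace ℝ (Fin 4)) ℂ),
              IsAppendTensorOf HF (osAdjoint F) F → IsAppendTensorOf HG (osAdjoint G) G →
                ‖Φ w‖ ^ 2 ≤ ‖S (n + n) HF‖ * ‖S (m + m) HG‖))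
    (hE : ∀ (S : SchwingerFamily (EuclideanSpace ℝ (Fin 4))), S.toLabelled.HasLinearGrowth →
        S.toLabelled.IsSymmetric →
        (∀ (n : ℕ) (a : EuclideanSpace ℝ (Fin 4)) (F : SchwartzMap (Fin n → EuclideanSpace ℝ (Fin 4)) ℂ),
          IsOffDiagonal F → S n (translateMulti a F) = S n F) →
        (∀ (R : EuclideanSpace ℝ (Fin 4) ≃ₗᵢ[ℝ] EuclideanSpace ℝ (Fin 4)) (a b : ℝ), a ^ 2 + b ^ 2 = 1 →
          (a = 0 ∨ b = 0 ∨ a ^ 2 = b ^ 2) →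
            R (EuclideanSpace.single 0 1) = a • EuclideanSpace.single 0 1 + b • EuclideanSpace.single 1 1 →
              (SchwingerFamily.toLabelled (fun n => (S n).comp (linActMulti R))).IsReflectionPositive) →
        ∀ (h : OSReconstructionNoE1 S.toLabelled) (n : ℕ)
          (F : SchwartzMap (Fin n → EuclideanSpace ℝ (Fin 4)) ℂ) (hF : IsTimeOrdered F),
          h.fieldVec n (fun _ => ()) F hF ∈
            ((Submodule.span ℂ (coneOrderedVecs h)).topologicalClosure : Set h.Hilbert)) :
    ∀ (S : SchwingerFamily (EuclideanSpace ℝ (Fin 4))), S.toLabelled.HasLinearGrowth →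
      S.toLabelled.IsSymmetric →
      (∀ (n : ℕ) (a : EuclideanSpace ℝ (Fin 4)) (F : SchwartzMap (Fin n → EuclideanSpace ℝ (Fin 4)) ℂ),
        IsOffDiagonal F → S n (translateMulti a F) = S n F) →
      (∀ (R : EuclideanSpace ℝ (Fin 4) ≃ₗᵢ[ℝ] EuclideanSpace ℝ (Fin 4)) (a b : ℝ), a ^ 2 + b ^ 2 = 1 →
        (a = 0 ∨ b = 0 ∨ a ^ 2 = b ^ 2) →
          R (EuclideanSpace.single 0 1) = a • EuclideanSpace.single 0 1 + b • EuclideanSpace.single 1 1 →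
            (SchwingerFamily.toLabelled (fun n => (S n).comp (linActMulti R))).IsReflectionPositive) →
      ∀ (n m : ℕ) (F : SchwartzMap (Fin n → EuclideanSpace ℝ (Fin 4)) ℂ)
        (G : SchwartzMap (Fin m → EuclideanSpace ℝ (Fin 4)) ℂ), IsTimeOrdered F → IsTimeOrdered G →
        ∃ Φ : ℂ × ℂ → ℂ, DifferentiableOn ℂ Φ {w : ℂ × ℂ | |w.2.im| < w.1.re} ∧
          (∀ (t b : ℝ), 0 < t → ∀ H : SchwartzMap (Fin (n + m) → EuclideanSpace ℝ (Fin 4)) ℂ,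
            IsAppendTensorOf H (osAdjoint F)
              (translateMulti (t • EuclideanSpace.single 0 1 + b • EuclideanSpace.single 1 1) G) →
              Φ ((t : ℂ), (b : ℂ)) = S (n + m) H) ∧
          (∀ w ∈ {w : ℂ × ℂ | |w.2.im| < w.1.re},
            ∀ (HF : SchwartzMap (Fin (n + n) → EuclideanSpace ℝ (Fin 4)) ℂ)
              (HG : SchwartzMap (Fin (m + m) → EuclideanSpace ℝ (Fin 4)) ℂ),
              IsAppendTensorOf HF (osAdjoint F) F → IsAppendTensorOf HG (osAdjoint G) G →
                ‖Φ w‖ ^ 2 ≤ ‖S (n + n) HF‖ * ‖S (m + m) HG‖) := by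
  intro S hE0' hE3 htr hRP n m F G hF hG
  have h : OSReconstructionNoE1 S.toLabelled := osReconstruction htr hRP
  have hV : ((Submodule.span ℂ (coneOrderedVecs h)).topologicalClosure : Set h.Hilbert) ⊆
      coneSupported h :=
    hC S h _ (coneOrderedVecs_subset_coneSupported hA hB hE0' hE3 htr hRP h)
  exact hD S h n m F G hF hG fun a b => hV
    (Submodule.add_mem _ (Submodule.smul_mem _ a (hE S hE0' hE3 htr hRP h n F hF))
      (Submodule.smul_mem _ b (hE S hE0' hE3 htr hRP h m G hG)))

/-- **The skeleton theorem**: concludes the crux `PlanarSpectralCone` BY NAME, closed modulo the five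
registered stubs (`stub_*` are the only sorries of this file). -/
theorem PlanarSpectralCone_of :
    Summit.QuantumFields.YangMills.Theses.MirrorModularBoosts.PlanarSpectralCone :=
  planarSpectralCone_of_stubs stub_discContinuation stub_coneOfDiscContinuation
    stub_coneSupportedClosedSpan stub_typedConeOfConeSupported stub_coneOrderedDense

end Summit.QuantumFields.YangMills.Cruxes.PlanarSpectralCone.ConeOrderedDensityHolomorphicGaps
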